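import Summits.SmoothPoincare4.SmoothPoincare4.Theorems.EntropyRungConicalGapStubWeightedIntegrability
import HarnessLib

/-!
# Helper `helper_compactTestIdentity` of line `Sketch` — the first-order test-function identity with
# compact support (crux `EntropyRung.ConicalGap`, stmt-SmoothPoincare4-16589; lead seat c5, cycle 5, localisation)

On a complete connected normalised gradient shrinking Ricci soliton `(Mⁿ, g, f)`
(`Ric + Hess f = g/2`, `R + |∇f|² = f`, closed `g`-balls compact), for every test function
`η ∈ C¹_c(ℝ)`,

  `∫_M [η′(f) (f − R) + η(f) (n/2 − R)] dV = 0`   (registered 4-d form: `n/2 = 2`),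

the integrand being continuous with compact support (hence integrable). This is the vanishing of
`∫_M Δ_g (H ∘ f) dV` for the primitive `H(t) = ∫_B^t η`, `B` beyond the support of `η`:

* `H ∈ C²(ℝ)`, `H′ = η`, and `H = η = η′ = 0` on `[B, ∞)` (`compactTestIdentity_exists_primitive`);
* pointwise, by the chain rule `Δ(H ∘ f) = H″(f) |∇f|² + H′(f) Δf` (`dalembertian_real_comp`) and the
  traced soliton identities `|∇f|² = f − R`, `Δf = n/2 − R`
  (`CarrilloNi2009_shrinkerLSI.scalarCurvature_add_dalembertian`):
  `Δ(H ∘ f) = η′(f)(f − R) + η(f)(n/2 − R)` (`compactTestIdentity_dalembertian_comp`);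
* `H ∘ f` has compact support inside the compact sublevel set `{f ≤ B}` (properness of `f`,
  `NoncompactShrinkerGapCarrilloNiClauses.scalarCurvature_nonneg_and_isCompact_sublevel`), so
  `∫ Δ(H ∘ f) dV = 0` by Green's identity for compactly supported functions
  (`integral_dalembertian_eq_zero_of_hasCompactSupport`): `compactTestIdentity_of_proper`.

Everything here is proved; no definition and no named fact is introduced.

## References

* Y. Wang, G. Wang (Wang–Wang 2023), arXiv:2308.06560, Prop. 2.6, (2.7)–(2.10) (the weighted
  identities being localised here).
* [CarrilloNi2009] J. Carrillo, L. Ni, Comm. Anal. Geom. 17 (2009) 721–753, §2 (2.1)–(2.3).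
* [Lee2018] J. M. Lee, *Introduction to Riemannian Manifolds*, 2nd ed., Problem 2-23 (c).
-/

noncomputable section

-- `Summit.SmoothPoincare4.SmoothPoincare4.…` (summit = problem) trips `dupNamespace` on every decl.
set_option linter.dupNamespace false

open scoped Manifold ContDiff ENNReal NNReal Topology
open MeasureTheory Set Filter
open Literature.Geometry.Lorentzian Literature.Geometry.Riemannian

namespace Summit.SmoothPoincare4.SmoothPoincare4.Theorems.ConicalGapSketch

/-! ## A `C²` primitive of a compactly supported `C¹` test function -/

/-- For `η ∈ C¹_c(ℝ)` there are `H ∈ C²(ℝ)` and `B ∈ ℝ` with `H′ = η` everywhere and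
`H = η = η′ = 0` on `[B, ∞)`: `H(t) = ∫_B^t η(s) ds` with `B` a strict upper bound of
`tsupport η` (fundamental theorem of calculus; `η′` vanishes off `tsupport η`). -/
theorem compactTestIdentity_exists_primitive {η : ℝ → ℝ} (hη : ContDiff ℝ 1 η)
    (hηc : HasCompactSupport η) :
    ∃ (H : ℝ → ℝ) (B : ℝ), ContDiff ℝ 2 H ∧ (∀ t, HasDerivAt H (η t) t) ∧
      (∀ t, B ≤ t → H t = 0) ∧ (∀ t, B ≤ t → η t = 0) ∧ (∀ t, B ≤ t → deriv η t = 0) := by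
  -- a strict upper bound `B` for the support of `η`
  obtain ⟨B₀, hB₀⟩ := hηc.isCompact.bddAbove
  have hout : ∀ t, B₀ < t → t ∉ tsupport η := fun t ht hmem ↦
    absurd (show t ≤ B₀ from hB₀ hmem) (not_le.2 ht)
  have hη0 : ∀ t, B₀ < t → η t = 0 := fun t ht ↦ image_eq_zero_of_notMem_tsupport (hout t ht)
  have hη'0 : ∀ t, B₀ < t → deriv η t = 0 := fun t ht ↦
    Function.notMem_support.1 fun hmem ↦ hout t ht (support_deriv_subset hmem)
  set B : ℝ := B₀ + 1 with hB
  have hηcont : Continuous η := hη.continuous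
  refine ⟨fun t ↦ ∫ s in B..t, η s, B, ?_, ?_, ?_, fun t ht ↦ hη0 t (by linarith),
    fun t ht ↦ hη'0 t (by linarith)⟩
  · have hd : ∀ t, HasDerivAt (fun u ↦ ∫ s in B..u, η s) (η t) t := fun t ↦
      (hηcont.integral_hasStrictDerivAt B t).hasDerivAt
    have hderiv : deriv (fun u ↦ ∫ s in B..u, η s) = η := funext fun t ↦ (hd t).deriv
    rw [show (2 : ℕ∞ω) = 1 + 1 from rfl, contDiff_succ_iff_deriv, hderiv]
    exact ⟨fun t ↦ (hd t).differentiableAt, by simp, hη⟩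
  · exact fun t ↦ (hηcont.integral_hasStrictDerivAt B t).hasDerivAt
  · intro t ht
    have hzero : EqOn η (fun _ ↦ (0 : ℝ)) (uIcc B t) := fun s hs ↦ by
      rw [uIcc_of_le ht] at hs
      exact hη0 s (by linarith [hs.1])
    show ∫ s in B..t, η s = 0
    rw [intervalIntegral.integral_congr hzero, intervalIntegral.integral_zero]

/-! ## The pointwise identity `Δ(H ∘ f) = η′(f)(f − R) + η(f)(n/2 − R)` (any dimension) -/

section Pointwise

variable {n : ℕ} {M : Type*} [TopologicalSpace M] [ChartedSpace (EuclideanSpace ℝ (Fin n)) M]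
  [IsManifold (𝓡 n) ∞ M]
  {g : PseudoRiemannianMetric (𝓡 n) ∞ (EuclideanSpace ℝ (Fin n)) (TangentSpace (𝓡 n) : M → Type _)}
  {f : M → ℝ} [g.HasLeviCivita]

/-- **`Δ(H ∘ f) = η′(f)(f − R) + η(f)(n/2 − R)`** on a gradient shrinker `Ric + Hess f = g/2`
normalised by `R + |∇f|² = f`, for `H ∈ C²(ℝ)` with `H′ = η`: the chain rule
`Δ(H ∘ f) = H″(f)|∇f|² + H′(f) Δf` (`dalembertian_real_comp`) with `|∇f|² = f − R` and
`Δf = n/2 − R` (`scalarCurvature_add_dalembertian`). -/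
theorem compactTestIdentity_dalembertian_comp
    (hsol : ∀ (x : M) (X Y : TangentSpace (𝓡 n) x),
      g.ricci x X Y + g.hessian f x X Y = (1 / 2 : ℝ) * g.val x X Y)
    (hnorm : ∀ x : M, g.scalarCurvature x + g.gradSq f x = f x)
    (hf : ContMDiff (𝓡 n) 𝓘(ℝ, ℝ) ∞ f) {H η : ℝ → ℝ} (hH : ContDiff ℝ 2 H)
    (hHd : ∀ t, HasDerivAt H (η t) t) (x : M) :
    g.dalembertian (fun y ↦ H (f y)) x =
      deriv η (f x) * (f x - g.scalarCurvature x) + η (f x) * (n / 2 - g.scalarCurvature x) := by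
  have hfx : ContMDiffAt (𝓡 n) 𝓘(ℝ, ℝ) 2 f x := (hf.of_le ENat.LEInfty.out).contMDiffAt
  have hζ : ContDiffAt ℝ 2 H (f x) := hH.contDiffAt
  have hcomp := g.dalembertian_real_comp (ζ := H) hfx hζ
  have hd1 : deriv H = η := funext fun t ↦ (hHd t).deriv
  rw [show (fun y ↦ H (f y)) = H ∘ f from rfl, hcomp, hd1]
  have hgrad : g.innerDual x (mvfderiv (𝓡 n) f x).toLinearMap (mvfderiv (𝓡 n) f x).toLinearMap =
      g.gradSq f x := rfl
  rw [hgrad]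
  have h1 := CarrilloNi2009_shrinkerLSI.scalarCurvature_add_dalembertian hsol x
  have h2 := hnorm x
  have h3 : g.gradSq f x = f x - g.scalarCurvature x := by linarith
  have h4 : g.dalembertian f x = n / 2 - g.scalarCurvature x := by linarith
  rw [h3, h4]

end Pointwise

/-! ## The integrated identity on a shrinker with proper potential (any dimension) -/

section Proper

variable {n : ℕ} {M : Type*} [TopologicalSpace M] [ChartedSpace (EuclideanSpace ℝ (Fin n)) M]
  [IsManifold (𝓡 n) ∞ M] [T3Space M] [MeasurableSpace M] [BorelSpace M]
  {g : PseudoRiemannianMetric (𝓡 n) ∞ (EuclideanSpace ℝ (Fin n)) (TangentSpace (𝓡 n) : M → Type _)}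
  {f : M → ℝ} [g.HasLeviCivita]

/-- **The first-order test-function identity with compact support**, any dimension `n`: on a
gradient shrinker `Ric + Hess f = g/2`, `R + |∇f|² = f` with `g` Riemannian and `f` proper, for
every `η ∈ C¹_c(ℝ)` the function `η′(f)(f − R) + η(f)(n/2 − R)` is continuous with compact support
(so `dV`-integrable) and `∫ [η′(f)(f − R) + η(f)(n/2 − R)] dV = 0` — it is `Δ(H ∘ f)`
(`compactTestIdentity_dalembertian_comp`) for the compactly supported `C²` function `H ∘ f`,
`H = ∫_B^· η` (`compactTestIdentity_exists_primitive`), and `∫ Δ(H ∘ f) dV = 0`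
(`integral_dalembertian_eq_zero_of_hasCompactSupport`). -/
theorem compactTestIdentity_of_proper (hg : g.IsRiemannian) (hf : ContMDiff (𝓡 n) 𝓘(ℝ, ℝ) ∞ f)
    (hsol : ∀ (x : M) (X Y : TangentSpace (𝓡 n) x),
      g.ricci x X Y + g.hessian f x X Y = (1 / 2 : ℝ) * g.val x X Y)
    (hnorm : ∀ x : M, g.scalarCurvature x + g.gradSq f x = f x)
    (hprop : ∀ R : ℝ, IsCompact {x | f x ≤ R}) {η : ℝ → ℝ} (hη : ContDiff ℝ 1 η)
    (hηc : HasCompactSupport η) :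
    Integrable (fun x ↦ deriv η (f x) * (f x - g.scalarCurvature x) +
        η (f x) * (n / 2 - g.scalarCurvature x))
      (riemannianMeasure (g.toContMDiffRiemannianMetric hg)) ∧
    ∫ x, (deriv η (f x) * (f x - g.scalarCurvature x) +
        η (f x) * (n / 2 - g.scalarCurvature x))
      ∂(riemannianMeasure (g.toContMDiffRiemannianMetric hg)) = 0 := by
  classical
  -- topology supplied by the exhaustion; `dV` finite on compact sets
  haveI : LocallyCompactSpace M := Manifold.locallyCompact_of_finiteDimensional (M := M) (𝓡 n)
  haveI : SigmaCompactSpace M := ⟨⟨fun k : ℕ ↦ {x | f x ≤ k}, fun k ↦ hprop k,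
    eq_univ_of_forall fun x ↦ mem_iUnion.2 (exists_nat_ge (f x))⟩⟩
  haveI : IsFiniteMeasureOnCompacts (riemannianMeasure (g.toContMDiffRiemannianMetric hg)) :=
    ⟨fun K hK ↦ riemannianVolume_lt_top_of_isCompact_holds _ le_rfl hK⟩
  -- the primitive `H` of `η` vanishing on `[B, ∞)`
  obtain ⟨H, B, hH, hHd, hHB, hηB, hη'B⟩ := compactTestIdentity_exists_primitive hη hηc
  -- the test function `w = H ∘ f`: `C²`, compact support in `{f ≤ B}`
  have hw : ContMDiff (𝓡 n) 𝓘(ℝ, ℝ) 2 (fun y ↦ H (f y)) :=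
    hH.comp_contMDiff (hf.of_le ENat.LEInfty.out)
  have hwc : HasCompactSupport (fun y ↦ H (f y)) :=
    HasCompactSupport.intro (hprop B) fun x hx ↦ hHB _ (le_of_lt (lt_of_not_ge hx))
  -- pointwise `Δ w = η′(f)(f − R) + η(f)(n/2 − R)`
  have hpt : ∀ x, g.dalembertian (fun y ↦ H (f y)) x =
      deriv η (f x) * (f x - g.scalarCurvature x) + η (f x) * (n / 2 - g.scalarCurvature x) :=
    compactTestIdentity_dalembertian_comp hsol hnorm hf hH hHd
  have hfun : (fun x ↦ deriv η (f x) * (f x - g.scalarCurvature x) +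
      η (f x) * (n / 2 - g.scalarCurvature x)) = fun x ↦ g.dalembertian (fun y ↦ H (f y)) x :=
    funext fun x ↦ (hpt x).symm
  -- continuity and compact support of the integrand
  have hRc : Continuous fun x ↦ g.scalarCurvature x :=
    (PseudoRiemannianMetric.contMDiff_scalarCurvature g).continuous
  have hFc : Continuous fun x ↦ deriv η (f x) * (f x - g.scalarCurvature x) +
      η (f x) * (n / 2 - g.scalarCurvature x) :=
    (((hη.continuous_deriv le_rfl).comp hf.continuous).mul (hf.continuous.sub hRc)).add
      ((hη.continuous.comp hf.continuous).mul (continuous_const.sub hRc))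
  have hFsupp : HasCompactSupport fun x ↦ deriv η (f x) * (f x - g.scalarCurvature x) +
      η (f x) * (n / 2 - g.scalarCurvature x) := by
    refine HasCompactSupport.intro (hprop B) fun x hx ↦ ?_
    have hxB : B ≤ f x := le_of_lt (lt_of_not_ge hx)
    simp only [hηB _ hxB, hη'B _ hxB, zero_mul, add_zero]
  refine ⟨hFc.integrable_of_hasCompactSupport hFsupp, ?_⟩
  -- Green's identity for the compactly supported `w`
  rw [hfun]
  haveI := (PseudoRiemannianMetric.ofRiemannian (g.toContMDiffRiemannianMetric hg)).hasLeviCivita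
  exact integral_dalembertian_eq_zero_of_hasCompactSupport (g.toContMDiffRiemannianMetric hg) hw hwc

end Proper

/-! ## The registered stub (n = 4) -/

/-- **Helper `helper_compactTestIdentity` of line `Sketch`** (first-order test-function identity
with compact support, `n = 4`): on every complete connected normalised 4-d gradient shrinking Ricci
soliton and for every `η ∈ C¹_c(ℝ)`, the function `η′(f)(f − R) + η(f)(2 − R)` is `dV`-integrable
and `∫ [η′(f)(f − R) + η(f)(2 − R)] dV = 0` (`dV` the Riemannian measure of
`g.toContMDiffRiemannianMetric hg`): properness of `f`
(`scalarCurvature_nonneg_and_isCompact_sublevel`) and `compactTestIdentity_of_proper`. -/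
theorem helper_compactTestIdentity : ∀ (M : Type) [TopologicalSpace M] [T2Space M] [SecondCountableTopology M] [ChartedSpace (EuclideanSpace ℝ (Fin 4)) M] [IsManifold (𝓡 4) ∞ M] [ConnectedSpace M] [T3Space M] [MeasurableSpace M] [BorelSpace M] (g : Literature.Geometry.Lorentzian.PseudoRiemannianMetric (𝓡 4) ∞ (EuclideanSpace ℝ (Fin 4)) (TangentSpace (𝓡 4) : M → Type _)) [g.HasLeviCivita] (f : M → ℝ) (hg : g.IsRiemannian), (∀ (x : M) (r : NNReal), IsCompact {y : M | g.edist hg x y ≤ r}) → ContMDiff (𝓡 4) 𝓘(ℝ, ℝ) ∞ f → (∀ (x : M) (X Y : TangentSpace (𝓡 4) x), g.ricci x X Y + g.hessian f x X Y = (1 / 2 : ℝ) * g.val x X Y) → (∀ x : M, g.scalarCurvature x + g.gradSq f x = f x) → ∀ η : ℝ → ℝ, ContDiff ℝ 1 η → HasCompactSupport η → MeasureTheory.Integrable (fun x ↦ deriv η (f x) * (f x - g.scalarCurvature x) + η (f x) * (2 - g.scalarCurvature x)) (Literature.Geometry.Lorentzian.riemannianMeasure (g.toContMDiffRiemannianMetric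 hg)) ∧ ∫ x, (deriv η (f x) * (f x - g.scalarCurvature x) + η (f x) * (2 - g.scalarCurvature x)) ∂(Literature.Geometry.Lorentzian.riemannianMeasure (g.toContMDiffRiemannianMetric hg)) = 0 := by
  intro M _ _ _ _ _ _ _ _ _ g _ f hg hc hf hsol hnorm η hη hηc
  obtain ⟨-, -, hprop⟩ :=
    NoncompactShrinkerGapCarrilloNiClauses.scalarCurvature_nonneg_and_isCompact_sublevel g f hg hc hf
      hsol hnorm
  have h := compactTestIdentity_of_proper hg hf hsol hnorm hprop hη hηc
  norm_num at h
  exact h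

end Summit.SmoothPoincare4.SmoothPoincare4.Theorems.ConicalGapSketch

end
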